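import Summits.QuantumFields.YangMills.Theorems.BalabanUVNodesN12GaugeLetterLocOfPlaqSmall
import Summits.QuantumFields.YangMills.Theorems.BalabanUVNodesN12GaugeLetterLocExplicit
import HarnessLib

/-!
# BalabanUVNodes ∕ N12 — THE (σ)_N CAPSTONE, EXPLICIT AND WITH A FREE PLAQUETTE SCALE: `N12GaugeLetterLocExplicit` (budgets chosen, numerics folded) composed with `N12GaugeLetterLocOfPlaqSmall`
# (class factored out into a displayed graded bound `|U₀(∂p) − 1| < ε·η_j²`) — every tolerance term `∝ ε` or `∝ ρn`, the linear-in-guard reading of dag-n12-w5's (vii)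

Cell `pub-ymgap` (HUMAN RULINGS D-0062 ∕ D-0149), WIDTH SEAT `pub-ymgap-dag-n12-w3` g4 (node N12 = [B15]; key K1⁹ `stmt-QuantumFields-27364` (KEY MAP v2), `--kind proof --supports … --as
helper`; count-neutral).  THEOREMS ONLY (0 `def`, 0 `instance`, 0 `sorry`); composition by name.

WHY.  The matrix {class ∕ free `ε`} × {budgets displayed ∕ chosen} of (σ)_N editions lacks the corner «free `ε`, budgets chosen»: ★★★ `exists_gaugeLetterLoc_atRecord_explicit_of_plaqSmall` — the
(σ)_N letter of record at `𝐁_k(Z)` with tolerance `max ρn (((2ℓ_k+1+m′L^k)²∕4)·(ε·η₀²) + m′·κ(ε)·Σ_{l<k} Lˡ + m′·ρn)`, `κ(ε) = 6·(((d+2)L)²∕4)·(2εL²)`; RESIDUE: the minimiser `hmin`, the graded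
bound `hU` (free `ε > 0` — [Balaban1985Variational] Thm 1's output shape `omegaPlaqsTop = plaqsOf ∘ topSeq`), the region datum `W 𝒞 ρn`, the region geometry `hGN` ∕ `hN1` ∕ `hGmem`, NUMERICS
(Prop. 2's smallness + chart condition on `ε`, level guard, two lower bounds on `M₁`, cover divisibility).  With `ε, ρn ∝ e` the whole tolerance is `∝ e`.

HONEST FRAMING.  Composition by name; the minimiser ([15] Thm 1 ∕ (E)), the graded bound, the datum, the geometry letters and the numerics stay HYPOTHESES; nothing of Bałaban's asserted beyond
cited tree theorems; count-neutral; N12 NOT discharged; K1⁹ NOT closed; counts unmoved (typed 28∕28 · discharged 5∕27); one finite 𝕋⁴ programme at fixed ε — R4 closes the conditional rung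
`BalabanLadder.UV` only; SCALING in `L` is the scale-0 one (crude); the Yang–Mills mass gap (Clay) is NOT proved by any of this; nothing continuum ∕ ℝ⁴ ∕ OS.
-/

noncomputable section

open scoped Matrix.Norms.L2Operator BigOperators

namespace Summit.QuantumFields.YangMills.BalabanUVNodes.N12GaugeLetterLocExplicitOfPlaqSmall

open Literature.MathematicalPhysics.QuantumFieldTheory.Balaban1983to89
open T4Continuum GaugeField B15DeterminingSets BlockAveraging
open T4CubeChartGnomonic (SU2)
open B16Sect1Backgrounds (toMS)
open B14.Eq213MaximalDomains (side)
open B14.Eq213DetSet (Bj maxDomT)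
open B14.Eq216Concrete (inputs)
open B14.Eq22Determines (blockIter)
open B8Eq17ClassAkV1 (plaqsOf)
open ExpMeanLog (deltaSU)
open Literature.MathematicalPhysics.QuantumFieldTheory.BalabanImbrieJaffe1984to88.BIJ85Eq453GaugeField (qsstarGIter0)
open Summit.QuantumFields.YangMills.BalabanUVNodes.N12GaugeLetterLocNumerics (noWrap_of_levelGuard radius_le_of_M₁_ge)
open Summit.QuantumFields.YangMills.BalabanUVNodes.N12GaugeLetterLocExplicit (budget_succ)
open Summit.QuantumFields.YangMills.BalabanUVNodes.N12GaugeLetterLocOfPlaqSmall (exists_gaugeLetterLoc_atRecord_of_plaqSmall_geometry)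

variable {P : Params}

/-- ★★★ **THE (σ)_N LETTER OF RECORD, EXPLICIT, FREE PLAQUETTE SCALE.**  `N12GaugeLetterLocOfPlaqSmall.exists_gaugeLetterLoc_atRecord_of_plaqSmall_geometry` with the budgets `θ_j := κ(ε)·Σ_{l<j} Lˡ`
and the no-wrap ∕ radius numerics folded (`noWrap_of_levelGuard`, `radius_le_of_M₁_ge`).
[cite: Balaban1985Variational, (2)–(4) p.278, Thm 1 p.280, (16)–(18) p.280; Balaban1985Averaging, Prop. 2 (52)–(53) p.26; Balaban1988Convergent, (2.12)–(2.13) pp.256–257, (2.16) p.257, p.267] -/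
theorem exists_gaugeLetterLoc_atRecord_explicit_of_plaqSmall {F : T4Family} (ν : Node00.Stage7Numerics) (Kt : ℕ) {k : ℕ} (hk0 : 0 < k) (hk : k ≤ (F.P Kt).m + (F.P Kt).K)
    (hdiv : side (F.P Kt).L ν.M₁ k ∣ (F.P Kt).sitesPerDir 0) (Z : Set (Site (F.P Kt) 0))
    -- NUMERICS (i): a level guard `k + c ≤ m + K` with `4d + m′ + 3 < 2·L^c` (no wrapping), and `M₁ ≥ (4d + m′)·L² + 2d·L + 12` (radii), `m′ = 3·(d·((L−1)∕2)) + 5`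
    {c : ℕ} (hkc : k + c ≤ (F.P Kt).m + (F.P Kt).K) (hc : 4 * (F.P Kt).d + (3 * ((F.P Kt).d * (((F.P Kt).L - 1) / 2)) + 5) + 3 < 2 * (F.P Kt).L ^ c)
    (hMrad : (4 * (F.P Kt).d + (3 * ((F.P Kt).d * (((F.P Kt).L - 1) / 2)) + 5)) * (F.P Kt).L ^ 2 + 2 * (F.P Kt).d * (F.P Kt).L + 12 ≤ ν.M₁)
    -- the region-normalised datum and the minimiser
    {ρn : ℝ} (hρn : 0 ≤ ρn)
    (W : GaugeField (F.P Kt) k SU2) (𝒞 : Set (PBond (F.P Kt) k)) (hD : ∀ c ∈ 𝒞, dist1 (W c) ≤ ρn)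
    {U₀ : GaugeField (F.P Kt) 0 SU2}
    (hmin : IsMinimizer (Node00.avOfRecord F 2 Kt) (Node00.regMSCoPOfRecord F 2 ν Kt k (maxDomT ν.M₁ Z)) (Bj ν.M₁ Z k)
      (avgFamily (Node00.avOfRecord F 2 Kt) (qsstarGIter0 k W)) U₀)
    -- geometry of the neighbourhood (dag-n12-w6's letters, verbatim)
    (N : Set (PBond (F.P Kt) 0))
    (hGN : ∀ b ∈ N, (b.src ∉ maxDomT ν.M₁ Z 1 ∨ b.tgt ∉ maxDomT ν.M₁ Z 1) → blockIter k b.tgt ≠ blockIter k b.src →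
      (⟨blockIter k b.src, b.dir⟩ : PBond (F.P Kt) k) ∈ 𝒞)
    (hN1 : ∀ p : Plaq (F.P Kt) 0, ((⟨p.src, p.μ⟩ : PBond (F.P Kt) 0) ∈ {b : PBond (F.P Kt) 0 | b.src ∈ maxDomT ν.M₁ Z 1} ∨
        (⟨p.src.shift p.μ, p.ν⟩ : PBond (F.P Kt) 0) ∈ {b : PBond (F.P Kt) 0 | b.src ∈ maxDomT ν.M₁ Z 1} ∨
        (⟨p.src.shift p.ν, p.μ⟩ : PBond (F.P Kt) 0) ∈ {b : PBond (F.P Kt) 0 | b.src ∈ maxDomT ν.M₁ Z 1} ∨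
        (⟨p.src, p.ν⟩ : PBond (F.P Kt) 0) ∈ {b : PBond (F.P Kt) 0 | b.src ∈ maxDomT ν.M₁ Z 1}) →
      (⟨p.src, p.μ⟩ : PBond (F.P Kt) 0) ∈ N ∧ (⟨p.src.shift p.μ, p.ν⟩ : PBond (F.P Kt) 0) ∈ N ∧
        (⟨p.src.shift p.ν, p.μ⟩ : PBond (F.P Kt) 0) ∈ N ∧ (⟨p.src, p.ν⟩ : PBond (F.P Kt) 0) ∈ N)
    -- DISPLAYED: a graded plaquette bound for `U₀` on `{Ω_j}` with a FREE `ε > 0` ([15] Thm 1: `ε = B₃·δ̄`), small in Prop. 2's sense at `α₀ := ε·L²`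
    {ε : ℝ} (hεpos : 0 < ε)
    (hU : ∀ j ≤ k, PlaqSmallOn (plaqsOf (Node00.topSeq (Node00.suppDomOfRecord F ν Kt (maxDomT ν.M₁ Z)) (maxDomT ν.M₁ Z) j)) (ε * (F.P Kt).eta j ^ 2) U₀)
    (hα3 : (143 * (((((F.P Kt).d + 4 : ℕ) : ℝ)) ^ 2 / 4) ^ 2) * (ε * (F.P Kt).L ^ 2) ≤ 1 / 3)
    (hα2 : 2 * (ε * (F.P Kt).L ^ 2) ≤ 2 * deltaSU (Fin 2) / ((((F.P Kt).d + 4) * (F.P Kt).L : ℕ) : ℝ) ^ 2)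
    (haN : (((((F.P Kt).d + 2) * (F.P Kt).L : ℕ) : ℝ) ^ 2 / 4) * (2 * (ε * (F.P Kt).L ^ 2)) < deltaSU (Fin 2))
    -- the family's support numerics: `M₁ ≥ ((d+4)L + 6)·L²`
    (hM₁ : (((F.P Kt).d + 4) * (F.P Kt).L + 6) * (F.P Kt).L ^ 2 ≤ ν.M₁)
    -- GEOMETRY instead of the datum letter: the `k`-shadows of the face-crossing members of `𝐁_k(Z)` lie in `𝒞`
    (hGmem : ∀ i ≤ k, ∀ c ∈ bondsOf ((Bj ν.M₁ Z k : DetSet (F.P Kt)) i), blockIter k (embIter i c.tgt) ≠ blockIter k (embIter i c.src) →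
      (⟨blockIter k (embIter i c.src), c.dir⟩ : PBond (F.P Kt) k) ∈ 𝒞) :
    ∃ σ : GaugeTransf (F.P Kt) 0 SU2,
      (∀ j, j ≤ k → ∀ b ∈ bondsOf (Bj ν.M₁ Z k j), toMS σ j b.src = 1 ∧ toMS σ j b.tgt = 1) ∧
        (∀ p : Plaq (F.P Kt) 0, ((⟨p.src, p.μ⟩ : PBond (F.P Kt) 0) ∈ {b : PBond (F.P Kt) 0 | b.src ∈ maxDomT ν.M₁ Z 1} ∨
            (⟨p.src.shift p.μ, p.ν⟩ : PBond (F.P Kt) 0) ∈ {b : PBond (F.P Kt) 0 | b.src ∈ maxDomT ν.M₁ Z 1} ∨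
            (⟨p.src.shift p.ν, p.μ⟩ : PBond (F.P Kt) 0) ∈ {b : PBond (F.P Kt) 0 | b.src ∈ maxDomT ν.M₁ Z 1} ∨
            (⟨p.src, p.ν⟩ : PBond (F.P Kt) 0) ∈ {b : PBond (F.P Kt) 0 | b.src ∈ maxDomT ν.M₁ Z 1}) →
          ‖((gaugeAct σ U₀ ⟨p.src, p.μ⟩ : SU2) : Matrix (Fin 2) (Fin 2) ℂ) - 1‖ ≤
              max ρn ((((2 * (∑ i ∈ Finset.range (k + 1), ((F.P Kt).d * (((F.P Kt).L ^ i - 1) / 2) + 1)) + 1 +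
                  (3 * ((F.P Kt).d * (((F.P Kt).L - 1) / 2)) + 5) * (F.P Kt).L ^ k : ℕ) : ℝ)) ^ 2 / 4 * (ε * (F.P Kt).eta 0 ^ 2) +
                ((3 * ((F.P Kt).d * (((F.P Kt).L - 1) / 2)) + 5 : ℕ) : ℝ) * (6 * ((((((F.P Kt).d + 2) * (F.P Kt).L : ℕ) : ℝ) ^ 2 / 4) * (2 * (ε * (F.P Kt).L ^ 2))) * ∑ i ∈ Finset.range k, ((F.P Kt).L : ℝ) ^ i) + ((3 * ((F.P Kt).d * (((F.P Kt).L - 1) / 2)) + 5 : ℕ) : ℝ) * ρn) ∧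
            ‖((gaugeAct σ U₀ ⟨p.src.shift p.μ, p.ν⟩ : SU2) : Matrix (Fin 2) (Fin 2) ℂ) - 1‖ ≤
              max ρn ((((2 * (∑ i ∈ Finset.range (k + 1), ((F.P Kt).d * (((F.P Kt).L ^ i - 1) / 2) + 1)) + 1 +
                  (3 * ((F.P Kt).d * (((F.P Kt).L - 1) / 2)) + 5) * (F.P Kt).L ^ k : ℕ) : ℝ)) ^ 2 / 4 * (ε * (F.P Kt).eta 0 ^ 2) +
                ((3 * ((F.P Kt).d * (((F.P Kt).L - 1) / 2)) + 5 : ℕ) : ℝ) * (6 * ((((((F.P Kt).d + 2) * (F.P Kt).L : ℕ) : ℝ) ^ 2 / 4) * (2 * (ε * (F.P Kt).L ^ 2))) * ∑ i ∈ Finset.range k, ((F.P Kt).L : ℝ) ^ i) + ((3 * ((F.P Kt).d * (((F.P Kt).L - 1) / 2)) + 5 : ℕ) : ℝ) * ρn) ∧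
            ‖((gaugeAct σ U₀ ⟨p.src.shift p.ν, p.μ⟩ : SU2) : Matrix (Fin 2) (Fin 2) ℂ) - 1‖ ≤
              max ρn ((((2 * (∑ i ∈ Finset.range (k + 1), ((F.P Kt).d * (((F.P Kt).L ^ i - 1) / 2) + 1)) + 1 +
                  (3 * ((F.P Kt).d * (((F.P Kt).L - 1) / 2)) + 5) * (F.P Kt).L ^ k : ℕ) : ℝ)) ^ 2 / 4 * (ε * (F.P Kt).eta 0 ^ 2) +
                ((3 * ((F.P Kt).d * (((F.P Kt).L - 1) / 2)) + 5 : ℕ) : ℝ) * (6 * ((((((F.P Kt).d + 2) * (F.P Kt).L : ℕ) : ℝ) ^ 2 / 4) * (2 * (ε * (F.P Kt).L ^ 2))) * ∑ i ∈ Finset.range k, ((F.P Kt).L : ℝ) ^ i) + ((3 * ((F.P Kt).d * (((F.P Kt).L - 1) / 2)) + 5 : ℕ) : ℝ) * ρn) ∧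
            ‖((gaugeAct σ U₀ ⟨p.src, p.ν⟩ : SU2) : Matrix (Fin 2) (Fin 2) ℂ) - 1‖ ≤
              max ρn ((((2 * (∑ i ∈ Finset.range (k + 1), ((F.P Kt).d * (((F.P Kt).L ^ i - 1) / 2) + 1)) + 1 +
                  (3 * ((F.P Kt).d * (((F.P Kt).L - 1) / 2)) + 5) * (F.P Kt).L ^ k : ℕ) : ℝ)) ^ 2 / 4 * (ε * (F.P Kt).eta 0 ^ 2) +
                ((3 * ((F.P Kt).d * (((F.P Kt).L - 1) / 2)) + 5 : ℕ) : ℝ) * (6 * ((((((F.P Kt).d + 2) * (F.P Kt).L : ℕ) : ℝ) ^ 2 / 4) * (2 * (ε * (F.P Kt).L ^ 2))) * ∑ i ∈ Finset.range k, ((F.P Kt).L : ℝ) ^ i) + ((3 * ((F.P Kt).d * (((F.P Kt).L - 1) / 2)) + 5 : ℕ) : ℝ) * ρn)) ∧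
        (∀ b ∈ inputs (Bj ν.M₁ Z k), b ∈ N →
          ‖((gaugeAct σ U₀ b : SU2) : Matrix (Fin 2) (Fin 2) ℂ) - 1‖ ≤
              max ρn ((((2 * (∑ i ∈ Finset.range (k + 1), ((F.P Kt).d * (((F.P Kt).L ^ i - 1) / 2) + 1)) + 1 +
                  (3 * ((F.P Kt).d * (((F.P Kt).L - 1) / 2)) + 5) * (F.P Kt).L ^ k : ℕ) : ℝ)) ^ 2 / 4 * (ε * (F.P Kt).eta 0 ^ 2) +
                ((3 * ((F.P Kt).d * (((F.P Kt).L - 1) / 2)) + 5 : ℕ) : ℝ) * (6 * ((((((F.P Kt).d + 2) * (F.P Kt).L : ℕ) : ℝ) ^ 2 / 4) * (2 * (ε * (F.P Kt).L ^ 2))) * ∑ i ∈ Finset.range k, ((F.P Kt).L : ℝ) ^ i) + ((3 * ((F.P Kt).d * (((F.P Kt).L - 1) / 2)) + 5 : ℕ) : ℝ) * ρn)) := by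
  have hL2 : 2 ≤ (F.P Kt).L := (F.P Kt).hL.2
  have hM2 : 2 ≤ ν.M₁ := by
    have h4 : 4 ≤ (F.P Kt).L ^ 2 := by nlinarith [hL2]
    have h6 : 6 ≤ ((F.P Kt).d + 4) * (F.P Kt).L + 6 := by omega
    have h24 : 24 ≤ (((F.P Kt).d + 4) * (F.P Kt).L + 6) * (F.P Kt).L ^ 2 := Nat.mul_le_mul h6 h4
    omega
  have hN := noWrap_of_levelGuard (P := F.P Kt) hkc hc
  have hRad := radius_le_of_M₁_ge (P := F.P Kt) (k := k) hMrad
  have hκ0 : 0 ≤ 6 * ((((((F.P Kt).d + 2) * (F.P Kt).L : ℕ) : ℝ) ^ 2 / 4) * (2 * (ε * (F.P Kt).L ^ 2))) := by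
    have := hεpos.le; positivity
  exact exists_gaugeLetterLoc_atRecord_of_plaqSmall_geometry ν Kt hk0 hk hM2 hdiv Z hN hRad hρn W 𝒞 hD hmin N hGN hN1 hεpos hU hα3 hα2 haN
    (fun j => (6 * ((((((F.P Kt).d + 2) * (F.P Kt).L : ℕ) : ℝ) ^ 2 / 4) * (2 * (ε * (F.P Kt).L ^ 2))) * ∑ i ∈ Finset.range j, ((F.P Kt).L : ℝ) ^ i))
    (by simp) (fun j => (budget_succ (F.P Kt).L _ j).symm.le) hM₁ hGmem

end Summit.QuantumFields.YangMills.BalabanUVNodes.N12GaugeLetterLocExplicitOfPlaqSmall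

end
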